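import Summits.QuantumFields.BalabanUV.T4Continuum.Spine.NE3.SlicePoincareCoulombN
import Summits.QuantumFields.BalabanUV.T4Continuum.Spine.NE3.SlicB8LandauReduction
import Summits.QuantumFields.BalabanUV.T4Continuum.Support.NE3CovariantLineSumGauge
import HarnessLib

/-!
# T⁴ programme, node NE3 — census R43: THE END's LAST [B9]-§3-TYPE BINDER `hP` = (P♮) ON B8's SLICE `slicB8` AT A CURVED BACKGROUND IS REDUCED
# TO ONE INTERPOLATION SHAPE — (P♮) on `slicB8(W)` ⇐ the owner swarm's PROVED (P♮) on `T_♮(W)` ∧ a NESTED-MEAN COMPETITOR SHAPE (CS_W) ∧ two lines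

Cell `pub-balaban-gaps` (YM blitz, track G2, seat `ne3`, unit `pub-balaban-gaps-ne3-g10`; writer prover-pub-balaban-gaps-ne3-g10-0, 2026-08-25), census
`run/shared/lean/pub/pub-balaban-gaps/ne/NE3.md` §4 R43 ∕ §16.  WHAT.  THE END (`PairLandauB8EndSfClassH3sup.ne3EnergyRateWCov_sfClass_small_of_leafH3sup`) keeps,
per pair, `hP : SlicePoincare L (j+1) W (slicB8 L N (j+1) W) CP (periodBox (N·L^{j+1}))` at `W = cavg L U_B` — [Balaban1985BackgroundPropagators] Thm 3.3 TYPE.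
The owner swarm PROVED the curved (P♮) on its frame-free slice `T_♮(W)` (`NE3SlicePoincareCurved`, class form `NE3ClassSlicePoincare.classSlicePoincare_of_lines`);
R42 (`AvgKernelGaugeDecomposition`, `SlicePoincareCoulombN`) showed `ker QbarIter = T_♮(W) + gaugeDir W (N(Q′(W)))` and transferred (P♮) to the `N(Q′(W))`-Coulomb
slice.  THIS FILE does the transfer to `slicB8(W)` ITSELF, modulo ONE displayed shape:

  **(CS_W) NESTED-MEAN COMPETITOR SHAPE** with letters `(A, δ)`: every skew `(N·L^{j+1})`-periodic site field `ζ` has a competitor `u` with the SAME NESTED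
  TRANSPORTED BLOCK MEANS (`u − ζ ∈ avgKernelGauges L N (j+1) W`) and
  `2·Σ nhs (D_W u) + 32·M²·Σ nhs (Δ_W u) ≤ A·Σ nhs (D_W ζ) + δ·M⁻²·Σ nhs ζ`   (`M = L^{j+1}`, sums over the period box)
  — a C¹ covariant nested-mean interpolation lemma; at the FLAT background it is gen 6's smooth block-mean interpolant
  (`Support/NE3SmoothBlockMeanInterpolant` + coarse-gradient ≤ fine-gradient, `δ = 0`); at curved `W` it is the ONE remaining analytic input of `hP`.

MECHANISM.  For `Y ∈ slicB8(W)`: (1) R42 (a): `X := Y + gaugeDir W λ ∈ T_♮(W)`, `λ ∈ N(Q′(W))`; (2) covariant Hodge split of `X` (`NE3SpectralCutTorus.exists_covHodge_skew`):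
`X = η + D_W ζ_X`, `D*_W η = 0`, so `Y = η + D_W ζ_Y` with `ζ_Y = ζ_X − λ` IN THE SAME `N(Q′(W))`-COSET; (3) B8's (1.38) makes `ζ_Y` LAPLACIAN-MINIMAL in that coset, and
gen 5's reduction `SlicB8LandauReduction.sum_nhsNormSq_gaugeDir_le_of_isLandauB8` bounds `Σ‖D_Wζ_Y‖²` by `2Σ‖D_W u‖² + 32M²Σ‖Δ_W u‖²` for ANY competitor `u` of the coset;
(4) the competitor: SPECTRAL CUT of `ζ_X` at `ϑ = t∕M²` (`NE3SpectralCutTorus`: `ζ_X = c̃ + ζ′`, `Σ‖Δ_W c̃‖² ≤ ϑΣ‖D_Wζ_X‖²`, `Σ‖ζ′‖² ≤ ϑ⁻¹Σ‖D_Wζ_X‖²`, energies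
split) and `u := c̃ + u′` with `u′` the (CS_W)-competitor of the HIGH part `ζ′` — the low part is never undifferenced, the high part has no small divisor:
`Σ‖D_Wζ_Y‖² ≤ K_t·Σ‖D_Wζ_X‖²`, `K_t = 4 + 64t + 2(A + δ∕t)`; (5) Pythagoras twice: `Σ nhs Y ≤ (1 + K_t)·Σ nhs X`; (6) (P♮) on `T_♮(W)` for `X` and the curl
absorption of R42 (b) (`curlSq_W X ≤ 2curlSq_W Y + 2curlSq_W(D_Wλ)`, plaquette commutator × K6-Ξ Poincaré, `λ = ζ_X − ζ_Y`) under ONE displayed smallness.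

CONTENT (0 sorry, no `def`; [folklore]): **`slicePoincare_slicB8_of_frameFree_of_competitor`** — at every unitary `(N·L^{j+1})`-periodic background
of the tower's small-field class (K6-Ξ's `hsmall`): (P♮) on `T_♮(W)` with `C ≥ 0` ∧ (CS_W) with `(A, δ) ≥ 0`, `t > 0` ∧ `128·(5 + 64t + 2(A + δ∕t))·C·#planes·card n·(M²x)² ≤ 1`
⟹ `SlicePoincare L (j+1) W (slicB8 L N (j+1) W) (4·card n·(5 + 64t + 2(A + δ∕t))·C) (periodBox (N·L^{j+1}))`;
**`slicePoincare_slicB8_sfClass_of_competitor`** — OVER BAŁABAN's CLASS: the owner's four lines + the transfer line ⟹ `∀ j W ∈ sfClass d L N ε (j+1)`, (CS_W) at `W`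
⟹ (P♮) on `slicB8 L N (j+1) W` with the k-FREE constant `4·card n·(5 + 64t + 2(A + δ∕t))·CPLine`.

HONEST FRAMING.  A REDUCTION: `hP` ⇐ (CS_W) + the owner swarm's theorem + lines; (CS_W) at curved `W` is NOT proved here (flat: gen 6); nothing of Bałaban's asserted;
(P♮) on `slicB8` at curved `W`, `PairLandauGaugeB8Avg`, (H3ˢᵘᵖ), the covariant root and **NE3 are NOT proved**; spine PROVED 0∕9; finite T⁴ rung (B)+1 — NOT continuum YM on
ℝ⁴, NOT infinite volume, NOT mass gap, NOT Clay.  PLACEMENT: `Summits/QuantumFields/BalabanUV/T4Continuum/Spine/NE3/`; imports accepted modules only; moves nothing.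
-/

set_option autoImplicit false

open scoped BigOperators Matrix Matrix.Norms.L2Operator
open Finset

namespace Summit.QuantumFields.BalabanUV.T4Continuum.NE3.SlicePoincareSlicB8Reduction

open Literature.MathematicalPhysics.QuantumFieldTheory.Balaban1983to89
open B7Prop1Explicit B7Prop2Explicit MatrixNorms
open T4AveragingDeficitWall (IsUnitaryCfg IsSkewDir SmallField Ad Plane curl curlSq dirSq)
open T4AveragingDeficitWallBoundary (IsPeriodicCfg periodBox mem_periodBox)
open AveragingDeficitPeriodicCounting (IsPeriodicDir)
open AveragingDeficitTwoLevelPrep (prop1Radius)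
open AveragingDeficitMultiLevelPrep (tower LevelSmall)
open SpreadLift (loopRad)
open BlockAveragePushDirGauge (gaugeDir isPeriodicDir_gaugeDir)
open NE3TangentCovariantTower (QbarIter)
open NE3TangentCovariantStructure (gaugeDir_add_fun)
open NE3CovariantCalculus (hsR nhsNormSq_sub nhsNormSq_sub_le nhsNormSq_neg)
open NE3CovariantWeitzenbock (covDiv)
open NE3LandauOrbit (nhsNormSq_add gaugeDir_skew sum_hsR_gaugeDir hsR_zero_left)
open NE3CovariantBlockMean (bmeanIterW)
open NE3CornerGaugePoincare (sum_nhsNormSq_le_four_mul_of_bmeanIterW_eq_zero)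
open NE3CurlOfGaugeDir (curlSq_gaugeDir_le)
open NE3CovariantLineSumsError (sq_mul_le_prop1Radius)
open NE3FrameFreeSliceW (frameFreeBlockLandauW bmeanIterW_add)
open NE3FrameFreeDecompositionW (gaugeDir_sub_fun)
open NE3SlicePoincareShape (SlicePoincare)
open NE3SpectralCutTorus (cutLow cutHigh cutLow_add_period cutHigh_add_period cutLow_add_cutHigh sum_nhsNormSq_cutHigh_le
  sum_nhsNormSq_covDiv_gaugeDir_cutLow_le sum_nhsNormSq_gaugeDir_cutHigh_le sum_nhsNormSq_gaugeDir_cutLow_le cutLow_mem_skewAdjoint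
  cutHigh_mem_skewAdjoint exists_covHodge_skew)
open NE3SlicePoincareBudgetLine (CPLine ShLine SmallYLine)
open NE3CovariantLineSumsL2 (C2sq)
open NE3CovariantLineSumsL2Tower (rho)
open NE3ClassSlicePoincare (xi_of_line classSlicePoincare_of_lines)
open MinimalActionRate (sfClass)
open NE3.PairLandauB8 (avgKernelGauges mem_avgKernelGauges_iff covLapSite IsLandauB8)
open NE3.PairLandauB8Avg (slicB8 mem_slicB8_iff)
open NE3.LandauProjectionB8 (covDiv_gaugeDir_eq_covLapSite covLapSite_add)
open NE3.SlicB8LandauReduction (sum_nhsNormSq_gaugeDir_le_of_isLandauB8)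
open NE3.AvgKernelGaugeDecomposition (exists_avgKernelGauge_mem_frameFreeBlockLandauW)
open NE3.SlicePoincareCoulombN (CPLine_nonneg)
open NE3HatInvCurlLetters (curlSq_add_le)
open NE3CovariantLineSumCore (nhsNormSq_add_le)

noncomputable section

variable {d : ℕ} {n : Type*} [Fintype n] [DecidableEq n]

/-! ## §1 The reduction at one background of the class -/

/-- **(P♮) ON `slicB8(W)` FROM (P♮) ON `T_♮(W)` AND THE NESTED-MEAN COMPETITOR SHAPE (CS_W)** (`1 ≤ d`, `2 ≤ L`, `1 ≤ N`; unitary `W` of period `N·L^{j+1}` in the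
tower's small-field class — `0 ≤ x`, `LevelSmall d L j x`, `SmallField W x`, K6-Ξ's `hsmall`; `M = L^{j+1}`): if (P♮) holds on `frameFreeBlockLandauW L N (j+1) W` with
constant `C ≥ 0`, if (CS_W) holds with letters `A, δ ≥ 0`, if `t > 0` and `128·(5 + 64t + 2(A + δ∕t))·C·#planes·card n·(M²x)² ≤ 1`, then
`SlicePoincare L (j+1) W (slicB8 L N (j+1) W) (4·card n·(5 + 64t + 2(A + δ∕t))·C) (periodBox (N·L^{j+1}))`. [folklore] -/
theorem slicePoincare_slicB8_of_frameFree_of_competitor [Nonempty n] (hd : 1 ≤ d) {L N : ℕ} (hL : 2 ≤ L) (hN : 1 ≤ N) (j : ℕ)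
    {W : Site d → Fin d → (Matrix n n ℂ)ˣ} {x : ℝ} (hWu : IsUnitaryCfg W) (hWP : IsPeriodicCfg W ((N * L ^ (j + 1) : ℕ) : ℤ))
    (hx : 0 ≤ x) (hs : LevelSmall d L j x) (hWx : SmallField W x)
    (hsmall : 8 * d * (((L : ℝ) ^ (j + 1)) * (((d : ℝ) - 1) * (((L : ℝ) ^ (j + 1)) - 1) * x)) ^ 2
      + 2 * (Fintype.card n * (4 * (d : ℝ) ^ 2 * ((L : ℝ) ^ (j + 1) - 1) ^ 2 * x + 16 * d * loopRad d L ((prop1Radius d L)^[j] x)) ^ 2)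
        ≤ 1 / 2)
    {C : ℝ} (hC : 0 ≤ C)
    (hP : SlicePoincare L (j + 1) W (frameFreeBlockLandauW (d := d) (n := n) L N (j + 1) W) C (periodBox (d := d) (N * L ^ (j + 1))))
    {A δ t : ℝ} (hA : 0 ≤ A) (hδ : 0 ≤ δ) (ht : 0 < t)
    (hCS : ∀ ζ : Site d → Matrix n n ℂ, (∀ y, ζ y ∈ skewAdjoint (Matrix n n ℂ)) →
        (∀ (y : Site d) (i : Fin d), ζ (y + ((N * L ^ (j + 1) : ℕ) : ℤ) • e i) = ζ y) →
        ∃ u : Site d → Matrix n n ℂ, (fun y => u y - ζ y) ∈ avgKernelGauges (d := d) (n := n) L N (j + 1) W ∧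
          2 * (∑ y ∈ periodBox (d := d) (N * L ^ (j + 1)), ∑ κ : Fin d, nhsNormSq (gaugeDir W u y κ))
              + 32 * ((L : ℝ) ^ (j + 1)) ^ 2 * ∑ y ∈ periodBox (d := d) (N * L ^ (j + 1)), nhsNormSq (covLapSite W u y)
            ≤ A * (∑ y ∈ periodBox (d := d) (N * L ^ (j + 1)), ∑ κ : Fin d, nhsNormSq (gaugeDir W ζ y κ))
              + δ * (((L : ℝ) ^ (j + 1)) ^ 2)⁻¹ * ∑ y ∈ periodBox (d := d) (N * L ^ (j + 1)), nhsNormSq (ζ y))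
    (hθ : 128 * (5 + 64 * t + 2 * (A + δ / t)) * C * (Fintype.card (Plane d) : ℝ) * (Fintype.card n : ℝ)
      * (((L : ℝ) ^ (j + 1)) ^ 2 * x) ^ 2 ≤ 1) :
    SlicePoincare L (j + 1) W (slicB8 (d := d) (n := n) L N (j + 1) W)
      (4 * (Fintype.card n : ℝ) * (5 + 64 * t + 2 * (A + δ / t)) * C) (periodBox (d := d) (N * L ^ (j + 1))) := by
  intro Y hY
  obtain ⟨hYs, hYP, hLan, hQ⟩ := mem_slicB8_iff.mp hY
  have hL1 : 1 ≤ L := by omega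
  have hLd : 2 ≤ L ^ d := by
    calc 2 ≤ L := hL
      _ = L ^ 1 := (pow_one L).symm
      _ ≤ L ^ d := Nat.pow_le_pow_right (by omega) hd
  haveI : NeZero N := ⟨by omega⟩
  have hP1 : 1 ≤ N * L ^ (j + 1) := Nat.one_le_iff_ne_zero.mpr (Nat.mul_ne_zero (by omega) (pow_ne_zero _ (by omega)))
  haveI : NeZero (N * L ^ (j + 1)) := ⟨by omega⟩
  have hM0 : (0 : ℝ) < (L : ℝ) ^ (j + 1) := by positivity
  have hM2 : (0 : ℝ) < ((L : ℝ) ^ (j + 1)) ^ 2 := by positivity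
  obtain ⟨F, hF⟩ : ∃ F : Finset (Site d), F = periodBox (d := d) (N * L ^ (j + 1)) := ⟨_, rfl⟩
  obtain ⟨Kt, hKt⟩ : ∃ K : ℝ, K = 4 + 64 * t + 2 * (A + δ / t) := ⟨_, rfl⟩
  have hKt0 : 0 ≤ Kt := by rw [hKt]; positivity
  have hKt1 : 5 + 64 * t + 2 * (A + δ / t) = 1 + Kt := by rw [hKt]; ring
  -- (1) R42 (a): `X = Y + gaugeDir W λ ∈ T_♮(W)`, `λ ∈ N(Q′(W))`
  obtain ⟨lam, hlamN, -, hXT⟩ := exists_avgKernelGauge_mem_frameFreeBlockLandauW hL1 hLd j hWu hWP hx hs hWx hYs hYP hQ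
  obtain ⟨hlams, hlamP, hlam0⟩ := mem_avgKernelGauges_iff.mp hlamN
  obtain ⟨X, hXdef⟩ : ∃ X : Site d → Fin d → Matrix n n ℂ, X = fun y ν => Y y ν + gaugeDir W lam y ν := ⟨_, rfl⟩
  have hXmem : X ∈ frameFreeBlockLandauW (d := d) (n := n) L N (j + 1) W := by rw [hXdef]; exact hXT
  have hXs : IsSkewDir X := by
    rw [hXdef]; exact fun y ν => (skewAdjoint _).add_mem (hYs y ν) (gaugeDir_skew hWu hlams y ν)
  have hXP : IsPeriodicDir X ((N * L ^ (j + 1) : ℕ) : ℤ) := by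
    have hGP := isPeriodicDir_gaugeDir hWP hlamP
    rw [hXdef]; intro y i ν; simp only [hYP y i ν, hGP y i ν]
  -- (2) covariant Hodge split of `X`
  obtain ⟨η, ζX, hηP, hζXP, -, hζXs, hsplitX, hηdiv, hPythX⟩ := exists_covHodge_skew hWu hP1 hWP hXP hXs
  -- (3) `ζ_Y = ζ_X − λ`, `Y = η + D_W ζ_Y`
  obtain ⟨ζY, hζYdef⟩ : ∃ ζ : Site d → Matrix n n ℂ, ζ = fun y => ζX y - lam y := ⟨_, rfl⟩
  have hsplitY : ∀ (y : Site d) (κ : Fin d), Y y κ = η y κ + gaugeDir W ζY y κ := by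
    intro y κ
    have h1 : X y κ = Y y κ + gaugeDir W lam y κ := by rw [hXdef]
    rw [hζYdef, gaugeDir_sub_fun, ← add_sub_assoc, ← hsplitX y κ, h1]; abel
  have hζYP : ∀ (y : Site d) (i : Fin d), ζY (y + ((N * L ^ (j + 1) : ℕ) : ℤ) • e i) = ζY y := by
    intro y i; rw [hζYdef]; simp only [hζXP y i, hlamP y i]
  -- energies
  obtain ⟨EX, hEX⟩ : ∃ S : ℝ, S = ∑ y ∈ F, ∑ κ : Fin d, nhsNormSq (gaugeDir W ζX y κ) := ⟨_, rfl⟩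
  obtain ⟨EY, hEY⟩ : ∃ S : ℝ, S = ∑ y ∈ F, ∑ κ : Fin d, nhsNormSq (gaugeDir W ζY y κ) := ⟨_, rfl⟩
  obtain ⟨Sη, hSη⟩ : ∃ S : ℝ, S = ∑ y ∈ F, ∑ κ : Fin d, nhsNormSq (η y κ) := ⟨_, rfl⟩
  obtain ⟨SX, hSX⟩ : ∃ S : ℝ, S = ∑ y ∈ F, ∑ κ : Fin d, nhsNormSq (X y κ) := ⟨_, rfl⟩
  obtain ⟨SY, hSY⟩ : ∃ S : ℝ, S = ∑ y ∈ F, ∑ κ : Fin d, nhsNormSq (Y y κ) := ⟨_, rfl⟩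
  have hEX0 : 0 ≤ EX := by rw [hEX]; exact sum_nonneg fun _ _ => sum_nonneg fun _ _ => nhsNormSq_nonneg _
  have hSη0 : 0 ≤ Sη := by rw [hSη]; exact sum_nonneg fun _ _ => sum_nonneg fun _ _ => nhsNormSq_nonneg _
  have hPX' : SX = Sη + EX := by rw [hSX, hSη, hEX, hF]; exact hPythX
  -- (4) the spectral cut of `ζ_X` at `ϑ = t∕M²`
  obtain ⟨ϑ, hϑ⟩ : ∃ r : ℝ, r = t / ((L : ℝ) ^ (j + 1)) ^ 2 := ⟨_, rfl⟩
  have hϑ0 : 0 < ϑ := by rw [hϑ]; positivity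
  have hMϑ : ((L : ℝ) ^ (j + 1)) ^ 2 * ϑ = t := by rw [hϑ]; field_simp
  have hMϑ' : (((L : ℝ) ^ (j + 1)) ^ 2)⁻¹ * ϑ⁻¹ = t⁻¹ := by
    rw [← mul_inv, hMϑ]
  set cL : Site d → Matrix n n ℂ := cutLow W (N * L ^ (j + 1)) ϑ ζX with hcL
  set cH : Site d → Matrix n n ℂ := cutHigh W (N * L ^ (j + 1)) ϑ ζX with hcH
  have hcHs : ∀ y, cH y ∈ skewAdjoint (Matrix n n ℂ) := fun y => cutHigh_mem_skewAdjoint hWu hP1 hWP ϑ hζXP hζXs y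
  have hcHP : ∀ (y : Site d) (i : Fin d), cH (y + ((N * L ^ (j + 1) : ℕ) : ℤ) • e i) = cH y :=
    fun y i => cutHigh_add_period W (N * L ^ (j + 1)) ϑ ζX y i
  have hcLP : ∀ (y : Site d) (i : Fin d), cL (y + ((N * L ^ (j + 1) : ℕ) : ℤ) • e i) = cL y :=
    fun y i => cutLow_add_period W (N * L ^ (j + 1)) ϑ ζX y i
  have hsum : ∀ y, cL y + cH y = ζX y := fun y => cutLow_add_cutHigh W (N * L ^ (j + 1)) ϑ hζXP y
  -- cut inequalities
  have hHigh : ∑ y ∈ F, nhsNormSq (cH y) ≤ ϑ⁻¹ * EX := by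
    rw [hEX, hF]; exact sum_nhsNormSq_cutHigh_le W (N * L ^ (j + 1)) hϑ0 hζXP
  have hLowLap : ∑ y ∈ F, nhsNormSq (covLapSite W cL y) ≤ ϑ * EX := by
    rw [hEX, hF, ← covDiv_gaugeDir_eq_covLapSite]
    exact sum_nhsNormSq_covDiv_gaugeDir_cutLow_le hWu hP1 hWP hϑ0.le hζXP
  have hEH : ∑ y ∈ F, ∑ κ : Fin d, nhsNormSq (gaugeDir W cH y κ) ≤ EX := by
    rw [hEX, hF]; exact sum_nhsNormSq_gaugeDir_cutHigh_le W (N * L ^ (j + 1)) ϑ hζXP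
  have hEL : ∑ y ∈ F, ∑ κ : Fin d, nhsNormSq (gaugeDir W cL y κ) ≤ EX := by
    rw [hEX, hF]; exact sum_nhsNormSq_gaugeDir_cutLow_le W (N * L ^ (j + 1)) ϑ hζXP
  -- (CS_W) on the high part
  obtain ⟨u', hu'N, hcost⟩ := hCS cH hcHs hcHP
  rw [← hF] at hcost
  -- the competitor `u = c̃ + u′` lies in the coset of `ζ_Y`
  obtain ⟨u, hudef⟩ : ∃ u : Site d → Matrix n n ℂ, u = fun y => cL y + u' y := ⟨_, rfl⟩
  have huN : (fun y => u y - ζY y) ∈ avgKernelGauges (d := d) (n := n) L N (j + 1) W := by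
    have hform : (fun y => u y - ζY y) = (fun y => u' y - cH y) + lam := by
      funext y
      simp only [hudef, hζYdef, Pi.add_apply]
      rw [← hsum y]; abel
    rw [hform]
    obtain ⟨h1s, h1P, h10⟩ := mem_avgKernelGauges_iff.mp hu'N
    refine mem_avgKernelGauges_iff.mpr ⟨fun y => (skewAdjoint _).add_mem (h1s y) (hlams y), fun y i => ?_, ?_⟩
    · simp only [Pi.add_apply, h1P y i, hlamP y i]
    · rw [bmeanIterW_add, h10, hlam0, add_zero]
  -- (3′) the Landau reduction with this competitor
  have hred := sum_nhsNormSq_gaugeDir_le_of_isLandauB8 hL hN j hWu hWP hx hs hWx hsmall hYP hsplitY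
    (fun y _ => hηdiv y) hLan huN
  rw [← hF] at hred
  -- bounds on the competitor
  have hgu : ∑ y ∈ F, ∑ κ : Fin d, nhsNormSq (gaugeDir W u y κ)
      ≤ 2 * (∑ y ∈ F, ∑ κ : Fin d, nhsNormSq (gaugeDir W cL y κ)) + 2 * ∑ y ∈ F, ∑ κ : Fin d, nhsNormSq (gaugeDir W u' y κ) := by
    rw [mul_sum, mul_sum, ← sum_add_distrib]
    refine sum_le_sum fun y _ => ?_
    rw [mul_sum, mul_sum, ← sum_add_distrib]
    refine sum_le_sum fun κ _ => ?_
    rw [hudef, gaugeDir_add_fun]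
    have := nhsNormSq_add_le (gaugeDir W cL y κ) (gaugeDir W u' y κ)
    linarith
  have hlu : ∑ y ∈ F, nhsNormSq (covLapSite W u y)
      ≤ 2 * (∑ y ∈ F, nhsNormSq (covLapSite W cL y)) + 2 * ∑ y ∈ F, nhsNormSq (covLapSite W u' y) := by
    have hu2 : u = cL + u' := by rw [hudef]; funext y; simp
    have hsplit : covLapSite W u = covLapSite W cL + covLapSite W u' := by rw [hu2, covLapSite_add]
    rw [mul_sum, mul_sum, ← sum_add_distrib]
    refine sum_le_sum fun y _ => ?_
    rw [hsplit, Pi.add_apply]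
    have := nhsNormSq_add_le (covLapSite W cL y) (covLapSite W u' y)
    linarith
  -- (4′) `E_Y ≤ K_t · E_X`
  have hEYb : EY ≤ Kt * EX := by
    have hcost' : 2 * (∑ y ∈ F, ∑ κ : Fin d, nhsNormSq (gaugeDir W u' y κ))
        + 32 * ((L : ℝ) ^ (j + 1)) ^ 2 * ∑ y ∈ F, nhsNormSq (covLapSite W u' y) ≤ (A + δ / t) * EX := by
      refine hcost.trans ?_
      have h1 : A * (∑ y ∈ F, ∑ κ : Fin d, nhsNormSq (gaugeDir W cH y κ)) ≤ A * EX := mul_le_mul_of_nonneg_left hEH hA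
      have h2 : δ * (((L : ℝ) ^ (j + 1)) ^ 2)⁻¹ * ∑ y ∈ F, nhsNormSq (cH y) ≤ δ / t * EX := by
        calc δ * (((L : ℝ) ^ (j + 1)) ^ 2)⁻¹ * ∑ y ∈ F, nhsNormSq (cH y)
            ≤ δ * (((L : ℝ) ^ (j + 1)) ^ 2)⁻¹ * (ϑ⁻¹ * EX) := mul_le_mul_of_nonneg_left hHigh (by positivity)
          _ = δ * ((((L : ℝ) ^ (j + 1)) ^ 2)⁻¹ * ϑ⁻¹) * EX := by ring
          _ = δ / t * EX := by rw [hMϑ', div_eq_mul_inv]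
      linarith
    have h32 : 32 * ((L : ℝ) ^ (j + 1)) ^ 2 * (2 * ∑ y ∈ F, nhsNormSq (covLapSite W cL y)) ≤ 64 * t * EX := by
      have := mul_le_mul_of_nonneg_left hLowLap (show (0 : ℝ) ≤ 64 * ((L : ℝ) ^ (j + 1)) ^ 2 by positivity)
      calc 32 * ((L : ℝ) ^ (j + 1)) ^ 2 * (2 * ∑ y ∈ F, nhsNormSq (covLapSite W cL y))
          = 64 * ((L : ℝ) ^ (j + 1)) ^ 2 * ∑ y ∈ F, nhsNormSq (covLapSite W cL y) := by ring
        _ ≤ 64 * ((L : ℝ) ^ (j + 1)) ^ 2 * (ϑ * EX) := this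
        _ = 64 * (((L : ℝ) ^ (j + 1)) ^ 2 * ϑ) * EX := by ring
        _ = 64 * t * EX := by rw [hMϑ]
    rw [hEY, hKt]
    have hM32 : (0 : ℝ) ≤ 32 * ((L : ℝ) ^ (j + 1)) ^ 2 := by positivity
    linarith [hred, hgu, mul_le_mul_of_nonneg_left hlu hM32, hEL, hcost', h32]
  -- (5) `Σ nhs Y = Sη + E_Y ≤ (1 + K_t)·Σ nhs X`
  have hPY : SY = Sη + EY := by
    have horth : ∑ y ∈ F, ∑ κ : Fin d, hsR (η y κ) (gaugeDir W ζY y κ) = 0 := by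
      rw [hF, sum_hsR_gaugeDir hP1 hWu hηP hζYP]
      exact sum_eq_zero fun y _ => by rw [hηdiv y]; exact hsR_zero_left _
    rw [hSY, hSη, hEY]
    have : ∑ y ∈ F, ∑ κ : Fin d, nhsNormSq (Y y κ) = ∑ y ∈ F, ∑ κ : Fin d, (nhsNormSq (η y κ) + nhsNormSq (gaugeDir W ζY y κ)
        + 2 * hsR (η y κ) (gaugeDir W ζY y κ)) := by
      refine sum_congr rfl fun y _ => sum_congr rfl fun κ _ => ?_
      rw [hsplitY y κ, nhsNormSq_add]
    rw [this]
    simp only [sum_add_distrib, ← mul_sum, horth, mul_zero, add_zero]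
  have hKS : 0 ≤ Kt * Sη := mul_nonneg hKt0 hSη0
  have hSYX : SY ≤ (1 + Kt) * SX := by
    rw [hPY, hPX']
    linarith [hEYb, hSη0, hKS, hEX0]
  -- (6) `SX ≤ dirSq X`, (P♮) on `T_♮(W)` for `X`, and the curl absorption (as in R42 (b))
  have hSXdir : SX ≤ dirSq X F := by
    rw [hSX]; unfold dirSq
    exact sum_le_sum fun y _ => sum_le_sum fun κ _ => nhsNormSq_le_opNorm_sq _
  have hPX : dirSq X F ≤ ((L : ℝ) ^ (j + 1)) ^ 2 * (C * curlSq W X F) := by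
    have h := hP X hXmem
    rw [← hF, inv_pow, inv_mul_le_iff₀ hM2] at h
    exact h
  -- K6-Ξ's Poincaré on `λ` and the energy of `D_W λ = D_W ζ_X − D_W ζ_Y`
  have hPoinc : ∑ y ∈ F, nhsNormSq (lam y) ≤ 4 * (((L : ℝ) ^ (j + 1)) ^ 2 * ∑ y ∈ F, ∑ κ : Fin d, nhsNormSq (gaugeDir W lam y κ)) := by
    have hF' : F = periodBox (d := d) (L ^ (j + 1) * N) := by rw [hF, Nat.mul_comm]
    have h := sum_nhsNormSq_le_four_mul_of_bmeanIterW_eq_zero hL j hWu hx hs hWx N lam (fun z _ => by rw [hlam0]; rfl) hsmall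
    rw [hF']; exact h
  have hElam : ∑ y ∈ F, ∑ κ : Fin d, nhsNormSq (gaugeDir W lam y κ) ≤ 2 * EX + 2 * EY := by
    rw [hEX, hEY, mul_sum, mul_sum, ← sum_add_distrib]
    refine sum_le_sum fun y _ => ?_
    rw [mul_sum, mul_sum, ← sum_add_distrib]
    refine sum_le_sum fun κ _ => ?_
    have e : gaugeDir W lam y κ = gaugeDir W ζX y κ - gaugeDir W ζY y κ := by
      rw [hζYdef, gaugeDir_sub_fun]; abel
    rw [e]
    have := nhsNormSq_sub_le (gaugeDir W ζX y κ) (gaugeDir W ζY y κ)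
    linarith
  have hElam' : ∑ y ∈ F, ∑ κ : Fin d, nhsNormSq (gaugeDir W lam y κ) ≤ 2 * (1 + Kt) * (((L : ℝ) ^ (j + 1)) ^ 2 * (C * curlSq W X F)) := by
    have h1 : 2 * EX + 2 * EY ≤ 2 * (1 + Kt) * SX := by rw [hPX']; linarith [hEYb, hSη0, hKS, hEX0]
    have h2 : 2 * (1 + Kt) * SX ≤ 2 * (1 + Kt) * (((L : ℝ) ^ (j + 1)) ^ 2 * (C * curlSq W X F)) :=
      mul_le_mul_of_nonneg_left (hSXdir.trans hPX) (by positivity)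
    linarith [hElam]
  have hcurlX0 : 0 ≤ curlSq W X F := by unfold curlSq; positivity
  have hcurlX : curlSq W X F ≤ 4 * curlSq W Y F := by
    have h1 : curlSq W X F ≤ 2 * curlSq W Y F + 2 * curlSq W (gaugeDir W lam) F := by
      have e : X = Y + gaugeDir W lam := by rw [hXdef]; funext y ν; simp
      rw [e]; exact curlSq_add_le W Y (gaugeDir W lam) F
    have h2 : curlSq W (gaugeDir W lam) F
        ≤ 4 * x ^ 2 * (Fintype.card (Plane d) : ℝ) * ((Fintype.card n : ℝ) * (4 * (((L : ℝ) ^ (j + 1)) ^ 2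
            * (2 * (1 + Kt) * (((L : ℝ) ^ (j + 1)) ^ 2 * (C * curlSq W X F)))))) := by
      have ha := curlSq_gaugeDir_le hWu hWx lam F
      have hb : ∑ z ∈ F, ‖lam z‖ ^ 2 ≤ (Fintype.card n : ℝ) * ∑ z ∈ F, nhsNormSq (lam z) := by
        rw [mul_sum]; exact sum_le_sum fun z _ => opNorm_sq_le_card_mul_nhsNormSq _
      have hc : ∑ z ∈ F, nhsNormSq (lam z) ≤ 4 * (((L : ℝ) ^ (j + 1)) ^ 2 * (2 * (1 + Kt) * (((L : ℝ) ^ (j + 1)) ^ 2 * (C * curlSq W X F)))) :=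
        hPoinc.trans (mul_le_mul_of_nonneg_left (mul_le_mul_of_nonneg_left hElam' (by positivity)) (by norm_num))
      exact ha.trans (mul_le_mul_of_nonneg_left (hb.trans (mul_le_mul_of_nonneg_left hc (by positivity))) (by positivity))
    have h3 : 2 * (4 * x ^ 2 * (Fintype.card (Plane d) : ℝ) * ((Fintype.card n : ℝ) * (4 * (((L : ℝ) ^ (j + 1)) ^ 2
            * (2 * (1 + Kt) * (((L : ℝ) ^ (j + 1)) ^ 2 * (C * curlSq W X F)))))))
        = (64 * (1 + Kt) * C * (Fintype.card (Plane d) : ℝ) * (Fintype.card n : ℝ) * (((L : ℝ) ^ (j + 1)) ^ 2 * x) ^ 2) * curlSq W X F := by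
      ring
    have h4 : (64 * (1 + Kt) * C * (Fintype.card (Plane d) : ℝ) * (Fintype.card n : ℝ) * (((L : ℝ) ^ (j + 1)) ^ 2 * x) ^ 2) * curlSq W X F
        ≤ (1 / 2) * curlSq W X F := by
      refine mul_le_mul_of_nonneg_right ?_ hcurlX0
      rw [← hKt1]; linarith
    linarith
  -- (7) assemble
  have hdirY : dirSq Y F ≤ (Fintype.card n : ℝ) * SY := by
    rw [hSY, mul_sum]; unfold dirSq
    refine sum_le_sum fun y _ => ?_
    rw [mul_sum]
    exact sum_le_sum fun κ _ => opNorm_sq_le_card_mul_nhsNormSq _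
  have hcn0 : (0 : ℝ) ≤ (Fintype.card n : ℝ) := by positivity
  have hchain : dirSq Y F ≤ (Fintype.card n : ℝ) * ((1 + Kt) * (((L : ℝ) ^ (j + 1)) ^ 2 * (C * (4 * curlSq W Y F)))) := by
    calc dirSq Y F ≤ (Fintype.card n : ℝ) * SY := hdirY
      _ ≤ (Fintype.card n : ℝ) * ((1 + Kt) * SX) := mul_le_mul_of_nonneg_left hSYX hcn0
      _ ≤ (Fintype.card n : ℝ) * ((1 + Kt) * dirSq X F) := by gcongr
      _ ≤ (Fintype.card n : ℝ) * ((1 + Kt) * (((L : ℝ) ^ (j + 1)) ^ 2 * (C * curlSq W X F))) := by gcongr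
      _ ≤ (Fintype.card n : ℝ) * ((1 + Kt) * (((L : ℝ) ^ (j + 1)) ^ 2 * (C * (4 * curlSq W Y F)))) := by gcongr
  rw [← hF, inv_pow, inv_mul_le_iff₀ hM2, hKt1]
  calc dirSq Y F ≤ (Fintype.card n : ℝ) * ((1 + Kt) * (((L : ℝ) ^ (j + 1)) ^ 2 * (C * (4 * curlSq W Y F)))) := hchain
    _ = ((L : ℝ) ^ (j + 1)) ^ 2 * (4 * (Fintype.card n : ℝ) * (1 + Kt) * C * curlSq W Y F) := by ring

/-! ## §2 Over Bałaban's class, modulo (CS_W) at the background -/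

/-- **THE END's BINDER `hP` OVER `sfClass`, MODULO (CS_W)** (`3 ≤ d`, `2 ≤ L`, `1 ≤ N`; class radius `0 < ε ≤ θ`, K1 cut `0 < εc`, row Y9's family, the owner's four k-free lines
of `NE3ClassSlicePoincare.classSlicePoincare_of_lines`; (CS_W) letters `A, δ ≥ 0`, `t > 0`; the absorption line `128·(5 + 64t + 2(A + δ∕t))·CPLine·#planes·card n·ε² ≤ 1`): if (CS_W)
holds at every background of the class, then `∀ j W ∈ sfClass d L N ε (j+1), SlicePoincare L (j+1) W (slicB8 L N (j+1) W) (4·card n·(5 + 64t + 2(A + δ∕t))·CPLine) (periodBox (N·L^{j+1}))`.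
(With (CS_W) discharged — `NestedMeanCompetitorCurved.competitorShape_curved` — this is `NestedMeanCompetitorCurved.slicePoincare_slicB8_sfClass_of_lines`.) [folklore] -/
theorem slicePoincare_slicB8_sfClass_of_competitor [Nonempty n] (hd : 3 ≤ d) {L N : ℕ} (hL : 2 ≤ L) (hN : 1 ≤ N) {ε θ εc : ℝ}
    (hε : 0 < ε) (hεθ : ε ≤ θ) (hεc : 0 < εc)
    (hsmall : ∀ j : ℕ, LevelSmall d L (j + 1) (ε / ((L : ℝ) ^ (j + 2)) ^ 2))
    (h1 : ShLine d L (Fintype.card n) εc θ ≤ 1 / 2) (h2 : SmallYLine d L (Fintype.card n) εc θ ≤ 1 / 2)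
    (h3 : 68 / 3 * (((d : ℝ) + 1) * ((d : ℝ) + 4)) * C2sq d L * θ ≤ rho d L / 2)
    (h4 : 8 * d * (((d : ℝ) - 1) * θ) ^ 2
      + 2 * ((Fintype.card n : ℝ) * ((4 * (d : ℝ) ^ 2 + 272 * d * (((d : ℝ) + 1) * ((d : ℝ) + 4))) * θ) ^ 2) ≤ 1 / 2)
    {A δ t : ℝ} (hA : 0 ≤ A) (hδ : 0 ≤ δ) (ht : 0 < t)
    (hCS : ∀ j : ℕ, ∀ W : Site d → Fin d → (Matrix n n ℂ)ˣ, W ∈ sfClass d L N ε (j + 1) →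
      ∀ ζ : Site d → Matrix n n ℂ, (∀ y, ζ y ∈ skewAdjoint (Matrix n n ℂ)) →
        (∀ (y : Site d) (i : Fin d), ζ (y + ((N * L ^ (j + 1) : ℕ) : ℤ) • e i) = ζ y) →
        ∃ u : Site d → Matrix n n ℂ, (fun y => u y - ζ y) ∈ avgKernelGauges (d := d) (n := n) L N (j + 1) W ∧
          2 * (∑ y ∈ periodBox (d := d) (N * L ^ (j + 1)), ∑ κ : Fin d, nhsNormSq (gaugeDir W u y κ))
              + 32 * ((L : ℝ) ^ (j + 1)) ^ 2 * ∑ y ∈ periodBox (d := d) (N * L ^ (j + 1)), nhsNormSq (covLapSite W u y)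
            ≤ A * (∑ y ∈ periodBox (d := d) (N * L ^ (j + 1)), ∑ κ : Fin d, nhsNormSq (gaugeDir W ζ y κ))
              + δ * (((L : ℝ) ^ (j + 1)) ^ 2)⁻¹ * ∑ y ∈ periodBox (d := d) (N * L ^ (j + 1)), nhsNormSq (ζ y))
    (h5 : 128 * (5 + 64 * t + 2 * (A + δ / t)) * CPLine d L (Fintype.card n) εc θ * (Fintype.card (Plane d) : ℝ) * (Fintype.card n : ℝ) * ε ^ 2 ≤ 1) :
    ∀ j : ℕ, ∀ W : Site d → Fin d → (Matrix n n ℂ)ˣ, W ∈ sfClass d L N ε (j + 1) →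
      SlicePoincare L (j + 1) W (slicB8 (d := d) (n := n) L N (j + 1) W)
        (4 * (Fintype.card n : ℝ) * (5 + 64 * t + 2 * (A + δ / t)) * CPLine d L (Fintype.card n) εc θ) (periodBox (d := d) (N * L ^ (j + 1))) := by
  intro j W hW
  have hPcls := classSlicePoincare_of_lines (n := n) hd hL hN hε hεθ hεc hsmall h1 h2 h3 h4 j W hW
  have hCSW := hCS j W hW
  obtain ⟨hWu, hWP, hWx⟩ := hW
  have hd1 : 1 ≤ d := by omega
  have hL0 : (0 : ℝ) < L := by exact_mod_cast (show 0 < L by omega)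
  have hx : 0 ≤ ε / ((L : ℝ) ^ (j + 1)) ^ 2 := by positivity
  have hMx : ((L : ℝ) ^ (j + 1)) ^ 2 * (ε / ((L : ℝ) ^ (j + 1)) ^ 2) = ε := by field_simp
  have hθ' : ((L : ℝ) ^ (j + 1)) ^ 2 * (ε / ((L : ℝ) ^ (j + 1)) ^ 2) ≤ θ := by rw [hMx]; exact hεθ
  have hs : LevelSmall d L j (ε / ((L : ℝ) ^ (j + 1)) ^ 2) := by
    have hxy : ε / ((L : ℝ) ^ (j + 1)) ^ 2 ≤ prop1Radius d L (ε / ((L : ℝ) ^ (j + 2)) ^ 2) := by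
      have e : ε / ((L : ℝ) ^ (j + 1)) ^ 2 = (L : ℝ) ^ 2 * (ε / ((L : ℝ) ^ (j + 2)) ^ 2) := by
        field_simp; ring
      rw [e]; exact sq_mul_le_prop1Radius (d := d) L _
    exact AveragingDeficitMultiLevelPrep.LevelSmall.mono (d := d) hx hxy (hsmall j).2
  have hxi := xi_of_line (c := Fintype.card n) hd1 hL j hx hs hθ' h4
  have hCP0 : 0 ≤ CPLine d L (Fintype.card n) εc θ := CPLine_nonneg hd1 L (by positivity) hεc.le (hε.le.trans hεθ)
  have h5' : 128 * (5 + 64 * t + 2 * (A + δ / t)) * CPLine d L (Fintype.card n) εc θ * (Fintype.card (Plane d) : ℝ) * (Fintype.card n : ℝ)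
      * (((L : ℝ) ^ (j + 1)) ^ 2 * (ε / ((L : ℝ) ^ (j + 1)) ^ 2)) ^ 2 ≤ 1 := by rw [hMx]; exact h5
  exact slicePoincare_slicB8_of_frameFree_of_competitor hd1 hL hN j hWu hWP hx hs hWx hxi hCP0 hPcls hA hδ ht hCSW h5'

end

end Summit.QuantumFields.BalabanUV.T4Continuum.NE3.SlicePoincareSlicB8Reduction
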